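import Mathlib

/-!
# Ordered Marica–Schönheim inequality; the two-family inequality `MS2′`

Helper file for crux `stmt-CriticalPhenomena-4575` (`NoHeavyLowerTail`, route `PercNearOneGluingNoHeavy`),
new-inequality factory seat `prim-ineq-gen-3` (gen 5).  Pure finite set theory; everything here is PROVED.

**Theorem (ordered Marica–Schönheim, `card_le_card_of_sdiff_mem`).**  Let `A₁, …, Aₘ` be finite sets with
`Aᵢ ⊄ Aⱼ` whenever `i < j`.  Then the differences `Aᵢ \ Aⱼ` with `i ≤ j` are at least `m` many; more
precisely every family `T` containing all of them has `m ≤ #T`.  Ordering an arbitrary family by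
non-increasing cardinality recovers the Marica–Schönheim inequality `#𝒜 ≤ #(𝒜 \\ 𝒜)`
(`Finset.card_le_card_diffs`); putting a family `𝒞` before a family `ℬ` gives

**Corollary (`MS2′`, `card_add_card_le_card_diffs_union`).**  If no member of `𝒞` is contained in a member of
`ℬ`, then `#𝒞 + #ℬ ≤ #((𝒞 \\ 𝒞) ∪ (𝒞 \\ ℬ) ∪ (ℬ \\ ℬ))` — Marica–Schönheim for `𝒞 ∪ ℬ` with the block
`ℬ \\ 𝒞` dropped.  This is the hypothesis `hMS` of
`OrientedAntipodalHall.card_add_card_le_card_goods_above_chain` (chain classes of antipodal bads), conjectured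
and verified exhaustively on ground sets of size `≤ 4` by gens 3–4 of this seat; it is discharged in the
companion file `PercNearOneGluingNoHeavyLowerTailOrientedAntipodalHallChainMS`.

**Proof (a Möbius-weighted rank argument).**  Let `μ` be the Möbius weights of the poset `(T, ⊆)` relative to
`∅`, i.e. `∑_{E ∈ T, E ⊆ Z} μ E = [Z = ∅]` for `Z ∈ T`.  Put `P i E = μ E · [E ⊆ Aᵢ]` (an `m × T` matrix) and
`Q E j = [E ∩ Aⱼ = ∅]`.  Then `(P Q) i j = ∑_{E ∈ T, E ⊆ Aᵢ \ Aⱼ} μ E`, which for `i ≤ j` (so that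
`Aᵢ \ Aⱼ ∈ T`) equals `[Aᵢ ⊆ Aⱼ] = [i = j]`.  Hence `P Q` is unitriangular, `rank P = m`, and `m ≤ #T`.  The
statement proved (`card_le_card_of_rank`) allows any rank function into a linear order in place of the
indices (ties allowed between incomparable sets), which is the form used for `MS2′`.
(prim-ineq-gen-3 gen 5, 2026-08-20; memo `run/shared/lean/prim/prim-ineq-gen-3/COMB.md` §3c (xi), (xviii).)
-/

namespace Summit.CriticalPhenomena.PercolationContinuityZ3.Theorems

namespace OrderedDifferences

open Finset Matrix
open scoped FinsetFamily

variable {α : Type*} [DecidableEq α]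

/-- **Möbius weights.**  For a finite family `T` of finite sets there are rational weights `μ` with
`∑_{E ∈ T, E ⊆ Z} μ E = [Z = ∅]` for every `Z ∈ T` (the Möbius function of the poset `(T ∪ {∅}, ⊆)`
relative to `∅`; constructed on all finite sets by strong recursion `μ s = [s = ∅] - ∑_{t ∈ T, t ⊂ s} μ t`). -/
theorem exists_moebius_weights (T : Finset (Finset α)) :
    ∃ μ : Finset α → ℚ, ∀ Z ∈ T, ∑ E ∈ T.filter (· ⊆ Z), μ E = if Z = ∅ then 1 else 0 := by
  let H : (s : Finset α) → ((t : Finset α) → t ⊂ s → ℚ) → ℚ := fun s ih =>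
    (if s = ∅ then (1 : ℚ) else 0) - ∑ t ∈ (T.filter (· ⊂ s)).attach, ih t.1 (mem_filter.mp t.2).2
  let μ : Finset α → ℚ := Finset.strongInduction H
  have hμ : ∀ s, μ s = (if s = ∅ then (1 : ℚ) else 0) - ∑ t ∈ T.filter (· ⊂ s), μ t := by
    intro s
    have e : μ s = H s (fun t _ => μ t) := Finset.strongInduction_eq H s
    rw [e]
    show (if s = ∅ then (1 : ℚ) else 0) - ∑ t ∈ (T.filter (· ⊂ s)).attach, μ t.1 = _
    rw [sum_attach (T.filter (· ⊂ s)) (fun t => μ t)]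
  refine ⟨μ, fun Z hZ => ?_⟩
  have hsplit : T.filter (· ⊆ Z) = insert Z (T.filter (· ⊂ Z)) := by
    ext E
    simp only [mem_filter, mem_insert]
    constructor
    · rintro ⟨hE, hEZ⟩
      rcases lt_or_eq_of_le hEZ with h | h
      · exact Or.inr ⟨hE, h⟩
      · exact Or.inl h
    · rintro (rfl | ⟨hE, hEZ⟩)
      · exact ⟨hZ, subset_rfl⟩
      · exact ⟨hE, hEZ.le⟩
  have hnot : Z ∉ T.filter (· ⊂ Z) := by
    intro h
    exact lt_irrefl Z (mem_filter.mp h).2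
  rw [hsplit, sum_insert hnot, hμ]
  abel

/-- **Block form of the ordered Marica–Schönheim inequality.**  Let `A : ι → Finset α` be a finite family
with a rank function `r` into a linear order such that `A i ⊄ A j` for all `i ≠ j` with `r i ≤ r j`, and
let `T` contain every difference `A i \ A j` with `r i ≤ r j`.  Then `card ι ≤ #T`. -/
theorem card_le_card_of_rank {ι β : Type*} [Fintype ι] [DecidableEq ι] [LinearOrder β]
    (A : ι → Finset α) (r : ι → β) (hA : ∀ ⦃i j : ι⦄, i ≠ j → r i ≤ r j → ¬ A i ⊆ A j)
    (T : Finset (Finset α)) (hT : ∀ ⦃i j : ι⦄, r i ≤ r j → A i \ A j ∈ T) :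
    Fintype.card ι ≤ #T := by
  classical
  obtain ⟨μ, hμ⟩ := exists_moebius_weights T
  -- the key identity: for `r i ≤ r j`, `∑_{E ∈ T, E ⊆ A i \ A j} μ E = [i = j]`
  have key : ∀ i j : ι, r i ≤ r j →
      ∑ E ∈ T.filter (· ⊆ A i \ A j), μ E = if i = j then 1 else 0 := by
    intro i j hij
    rw [hμ _ (hT hij)]
    by_cases h : i = j
    · subst h
      simp
    · have hne : A i \ A j ≠ ∅ := fun h0 => hA h hij (sdiff_eq_empty_iff_subset.mp h0)
      simp [h, hne]
  -- the two matrices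
  let P : Matrix ι T ℚ := fun i E => if (E : Finset α) ⊆ A i then μ E else 0
  let Q : Matrix T ι ℚ := fun E j => if Disjoint (E : Finset α) (A j) then 1 else 0
  have hPQ : ∀ i j, (P * Q) i j = ∑ E ∈ T.filter (· ⊆ A i \ A j), μ E := by
    intro i j
    rw [Matrix.mul_apply]
    have h1 : ∑ E : T, P i E * Q E j =
        ∑ E ∈ T, (if E ⊆ A i then μ E else 0) * (if Disjoint E (A j) then 1 else 0) :=
      Finset.sum_coe_sort T (fun E => (if E ⊆ A i then μ E else 0) *
        (if Disjoint E (A j) then 1 else 0))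
    rw [h1, sum_filter]
    refine sum_congr rfl fun E _ => ?_
    by_cases ha : E ⊆ A i <;> by_cases hb : Disjoint E (A j) <;> simp [ha, hb, subset_sdiff]
  -- `P * Q` is block lower-triangular for `r` with identity diagonal blocks, hence invertible
  have hzero : ∀ i j : ι, i ≠ j → r i ≤ r j → (P * Q) i j = 0 := by
    intro i j hij hr
    rw [hPQ, key i j hr, if_neg hij]
  have hone : ∀ i : ι, (P * Q) i i = 1 := by
    intro i
    rw [hPQ, key i i le_rfl, if_pos rfl]
  have hBT : (P * Q).BlockTriangular (OrderDual.toDual ∘ r) := by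
    intro i j hij
    have hij' : r i < r j := hij
    exact hzero i j (fun h => by subst h; exact lt_irrefl _ hij') hij'.le
  have hdet : (P * Q).det = 1 := by
    rw [hBT.det]
    refine prod_eq_one fun a _ => ?_
    have hblock : (P * Q).toSquareBlock (OrderDual.toDual ∘ r) a = 1 := by
      ext ⟨i, hi⟩ ⟨j, hj⟩
      rw [toSquareBlock_def, of_apply]
      by_cases h : i = j
      · subst h
        rw [hone, one_apply_eq]
      · have hr : r i = r j := by
          have h1 : OrderDual.toDual (r i) = a := hi
          have h2 : OrderDual.toDual (r j) = a := hj
          exact OrderDual.toDual.injective (h1.trans h2.symm)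
        rw [hzero i j h hr.le, one_apply_ne (fun h' => h (Subtype.ext_iff.mp h'))]
    rw [hblock, det_one]
  have hunit : IsUnit (P * Q) := by
    rw [Matrix.isUnit_iff_isUnit_det, hdet]
    exact isUnit_one
  calc Fintype.card ι = (P * Q).rank := (rank_of_isUnit _ hunit).symm
    _ ≤ P.rank := rank_mul_le_left P Q
    _ ≤ Fintype.card T := rank_le_card_width P
    _ = #T := Fintype.card_coe T

/-- **Ordered Marica–Schönheim inequality.**  If `A₀, …, A_{m-1}` are finite sets with `Aᵢ ⊄ Aⱼ` for all
`i < j`, then every family `T` containing the differences `Aᵢ \ Aⱼ` (`i ≤ j`) has at least `m` members.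
(With `T = 𝒜 \\ 𝒜` and the members of `𝒜` listed by non-increasing size this is Marica–Schönheim.) -/
theorem card_le_card_of_sdiff_mem {m : ℕ} (A : Fin m → Finset α)
    (hA : ∀ ⦃i j : Fin m⦄, i < j → ¬ A i ⊆ A j) (T : Finset (Finset α))
    (hT : ∀ ⦃i j : Fin m⦄, i ≤ j → A i \ A j ∈ T) : m ≤ #T := by
  have h := card_le_card_of_rank A id (fun i j hij hle => hA (lt_of_le_of_ne hle hij)) T hT
  rwa [Fintype.card_fin] at h

/-- The number of distinct differences `Aᵢ \ Aⱼ`, `i ≤ j`, of a sequence with `Aᵢ ⊄ Aⱼ` (`i < j`) is at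
least its length. -/
theorem card_le_card_image_sdiff {m : ℕ} (A : Fin m → Finset α)
    (hA : ∀ ⦃i j : Fin m⦄, i < j → ¬ A i ⊆ A j) :
    m ≤ #((univ.filter fun p : Fin m × Fin m => p.1 ≤ p.2).image fun p => A p.1 \ A p.2) := by
  refine card_le_card_of_sdiff_mem A hA _ fun i j hij => ?_
  exact mem_image.mpr ⟨(i, j), mem_filter.mpr ⟨mem_univ _, hij⟩, rfl⟩

/-- **`MS2′` (two-family Marica–Schönheim).**  If no member of `𝒞` is contained in a member of `ℬ`, then
`#𝒞 + #ℬ ≤ #((𝒞 \\ 𝒞) ∪ (𝒞 \\ ℬ) ∪ (ℬ \\ ℬ))`. -/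
theorem card_add_card_le_card_diffs_union (𝒞 ℬ : Finset (Finset α))
    (h : ∀ C ∈ 𝒞, ∀ B ∈ ℬ, ¬ C ⊆ B) :
    #𝒞 + #ℬ ≤ #((𝒞 \\ 𝒞) ∪ (𝒞 \\ ℬ) ∪ (ℬ \\ ℬ)) := by
  classical
  -- `𝒞` and `ℬ` are disjoint families
  have hdisj : Disjoint 𝒞 ℬ := by
    rw [Finset.disjoint_left]
    intro X hXC hXB
    exact h X hXC X hXB subset_rfl
  -- index type: the members of `𝒞 ∪ ℬ`; rank: `𝒞` below `ℬ`, larger sets first inside each family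
  set K : ℕ := (𝒞 ∪ ℬ).sup card + 1 with hK
  have hcardK : ∀ X ∈ 𝒞 ∪ ℬ, #X < K := by
    intro X hX
    have := Finset.le_sup (f := card) hX
    omega
  let r : ↥(𝒞 ∪ ℬ) → ℤ := fun X => (if (X : Finset α) ∈ ℬ then (K : ℤ) else 0) - (#(X : Finset α) : ℤ)
  have hmain := card_le_card_of_rank (ι := ↥(𝒞 ∪ ℬ)) (fun X => (X : Finset α)) r ?_
    ((𝒞 \\ 𝒞) ∪ (𝒞 \\ ℬ) ∪ (ℬ \\ ℬ)) ?_
  · rwa [Fintype.card_coe, card_union_of_disjoint hdisj] at hmain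
  · -- non-containment along the rank
    rintro ⟨X, hX⟩ ⟨Y, hY⟩ hne hr hXY
    simp only [ne_eq, Subtype.mk.injEq] at hne
    simp only [r] at hr
    have hXK := hcardK X hX
    have hYK := hcardK Y hY
    rcases mem_union.mp hX with hXC | hXB <;> rcases mem_union.mp hY with hYC | hYB
    · -- both in 𝒞: then #Y ≤ #X, so X ⊆ Y forces X = Y
      rw [if_neg (Finset.disjoint_left.mp hdisj hXC), if_neg (Finset.disjoint_left.mp hdisj hYC)] at hr
      have hle : #Y ≤ #X := by omega
      exact hne (eq_of_subset_of_card_le hXY hle)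
    · exact h X hXC Y hYB hXY
    · rw [if_pos hXB, if_neg (Finset.disjoint_left.mp hdisj hYC)] at hr
      omega
    · rw [if_pos hXB, if_pos hYB] at hr
      have hle : #Y ≤ #X := by omega
      exact hne (eq_of_subset_of_card_le hXY hle)
  · -- the differences along the rank lie in the three blocks
    rintro ⟨X, hX⟩ ⟨Y, hY⟩ hr
    simp only [r] at hr
    have hXK := hcardK X hX
    have hYK := hcardK Y hY
    simp only [mem_union, mem_diffs]
    rcases mem_union.mp hX with hXC | hXB <;> rcases mem_union.mp hY with hYC | hYB
    · exact Or.inl (Or.inl ⟨X, hXC, Y, hYC, rfl⟩)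
    · exact Or.inl (Or.inr ⟨X, hXC, Y, hYB, rfl⟩)
    · rw [if_pos hXB, if_neg (Finset.disjoint_left.mp hdisj hYC)] at hr
      omega
    · exact Or.inr ⟨X, hXB, Y, hYB, rfl⟩

end OrderedDifferences

end Summit.CriticalPhenomena.PercolationContinuityZ3.Theorems
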